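import Mathlib.MeasureTheory.Integral.RieszMarkovKakutani.Real
import Mathlib.MeasureTheory.Integral.DominatedConvergence
import Mathlib.Analysis.Calculus.Deriv.Support
import Mathlib.Analysis.SpecificLimits.Basic
import Literature.NumberTheory.LFunctions.WeilBochnerExtension
import Literature.NumberTheory.LFunctions.WeilMellinInversion
import Literature.NumberTheory.LFunctions.WeilArchimedeanPositivityProofs
import Literature.Analysis.Fourier.BoasKacNonneg
import HarnessLib

/-!
# The Bochner–Kreĭn representation of the Weil functional on a window

Topic `Literature/NumberTheory/LFunctions` (normalisation of `WeilExplicit.lean`: tests `IsWeilTest`,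
transform `ĝ(s) = weilMellin g s`, functional `W = weilFunctional`, `Q(g) = W(g ⋆ g̃) = weilQuadratic g`,
window statement `WeilPositivityOn b = ∀ g smooth, supp g ⊆ [-b, b] → 0 ≤ Re Q(g)`).
Everything here is PROVED; there are no definitions and no named facts.

**Theorem** (`exists_measure_of_weilPositivityOn`, `weilPositivityOn_iff_exists_measure`).  For `b > 0`,

  `WeilPositivityOn b  ↔  ∃ μ ≥ 0 Borel measure on ℝ, ∀ g ∈ C_c^∞[-b, b],  Q(g) = ∫ ‖ĝ(½ + it)‖² dμ(t)`,

and `μ` may be taken regular (Radon).  In words: Weil positivity on the window `[-b, b]` holds exactly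
when, *for every observable whose prime side is supported in `[-2b, 2b]`, the explicit formula is
reproduced by a positive measure on the critical line* — the multiset of zeros of `ζ` is
indistinguishable, at prime-side resolution `2b`, from a positive measure on `Re s = ½`.  Under RH the
measure `Σ_γ m_γ δ_γ` serves every `b` at once (`explicit_formula_holds`); each proved rung
`WeilPositivityOn b` (tree: `b ≤ 4023/5000`) produces such a measure unconditionally.  The measure is
NOT unique (it is determined only on transforms of tests supported in `[-2b, 2b]`).

Proof.  (1) Boas–Kac/Kreĭn factorisation (`Literature.Analysis.Fourier.BoasKacNonneg`): a test `k`
supported in `[-2b, 2b]` with `k̂ ≥ 0` on the line is a square `φ ⋆ φ̃`, `supp φ ⊆ [-b, b]`; hence Weil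
positivity on `[-b, b]` gives `Re W(k) ≥ 0` on the cone of nonnegative transforms of the window `2b`
(`re_weilFunctional_nonneg_of_weilPositivityOn`).  (2) M. Riesz extension (tree:
`WeilBochner.exists_positive_extension`): a positive functional `Λ` on `C_c(ℝ, ℝ)` with
`Re W(k) + Λ c ≥ 0` whenever `Re k̂ + c ≥ 0`; Riesz–Markov–Kakutani (Mathlib `RealRMK.rieszMeasure`)
turns `Λ` into a regular measure `μ`.  (3) TIGHTNESS (the step that is usually "continuity at `0`" in
Kreĭn's theorem, here done by the derivative trick): with `F = ‖ĝ‖²`, `k = g ⋆ g̃`, `k₊ = g′ ⋆ g̃′`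
(`k̂₊ = t² F` on the line) and continuous cutoffs `χ_n = 1` on `[-n-1, n+1]`, `0 ≤ χ_n ≤ 1`, positivity
of the extension on `(k, -χ_n F)` and on `((n+1)⁻² k₊ - k, χ_n F)` gives the sandwich

  `Q(g) - (n+1)⁻² W(k₊) ≤ ∫ χ_n F dμ ≤ Q(g)`,

so `F ∈ L¹(μ)` (Fatou) and `∫ χ_n F dμ → ∫ F dμ = Q(g)` (dominated convergence).  No property of `W`
beyond real-linearity on tests and positivity on the window is used.

What is NOT here: the polarised (sesquilinear) identity `W(g ⋆ h̃) = ∫ ĝ conj ĥ dμ`, the growth bound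
`μ[-T, T] = O_b(T log T)`, evenness of `μ`, and the identification `μ = Σ_γ m_γ δ_γ` under RH.

## References

* M. G. Kreĭn, *Sur le problème du prolongement des fonctions hermitiennes positives et continues*,
  C. R. (Doklady) Acad. Sci. URSS 26 (1940), 17–22 [cite: Krein1940] (extension of positive definite
  functions from an interval; representation by a positive measure).
* R. P. Boas, M. Kac, *Inequalities for Fourier transforms of positive functions*, Duke Math. J. 12
  (1945) [cite: BoasKac1945] (factorisation `k = φ ⋆ φ̃`).
* E. Bombieri, *Remarks on Weil's quadratic functional in the theory of prime numbers, I*,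
  Rend. Mat. Acc. Lincei (9) 11 (2000), §§2–4 (the window functional).
-/

noncomputable section

open Complex Filter Set MeasureTheory CompactlySupported FourierTransform
open scoped Real Topology ContDiff ComplexConjugate ENNReal

namespace Literature.NumberTheory.LFunctions

namespace WeilBochner

variable {b : ℝ} {g k : ℝ → ℂ}

/-! ## From Weil positivity on `[-b, b]` to the cone of nonnegative transforms on `[-2b, 2b]` -/

/-- Mathlib's Fourier transform on the critical line: `𝓕 k ξ = k̂(½ - 2πiξ)` (the tree's
dictionary `fourier_weilKernel` at `c = ½`). [folklore] -/
private theorem fourierIntegral_eq_weilMellin_half (k : ℝ → ℂ) (ξ : ℝ) :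
    𝓕 k ξ = weilMellin k (1 / 2 + ((-(2 * π * ξ) : ℝ) : ℂ) * I) := by
  have h := fourier_weilKernel k (1 / 2) ξ
  have e : (fun t : ℝ ↦ k t * cexp ((((1 / 2 : ℝ) : ℂ) - 1 / 2) * t)) = k := by
    funext t; push_cast; simp
  rw [e] at h
  rw [h]
  push_cast
  ring_nf

/-- **Boas–Kac / Kreĭn factorisation in the tree's normalisation.**  A test `k` supported in
`[-2b, 2b]` (`b > 0`) whose transform on the critical line is a nonnegative real is a hermitian square:
`k = φ ⋆ φ̃` for a test `φ` supported in `[-b, b]`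
(`Literature.Analysis.Fourier.BoasKacNonneg.exists_smooth_autocorr_eq_of_fourier_nonneg`, transported
through `𝓕 k ξ = k̂(½ - 2πiξ)`). [cite: BoasKac1945, Thm 1] -/
theorem exists_sq_eq_of_weilMellin_nonneg (hb : 0 < b) (hk : IsWeilTest k)
    (hks : tsupport k ⊆ Icc (-(2 * b)) (2 * b))
    (hpos : ∀ t : ℝ, 0 ≤ (weilMellin k (1 / 2 + t * I)).re ∧ (weilMellin k (1 / 2 + t * I)).im = 0) :
    ∃ φ : ℝ → ℂ, IsWeilTest φ ∧ tsupport φ ⊆ Icc (-b) b ∧ weilConv φ (weilReflect φ) = k := by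
  obtain ⟨f, hf, hfc, hfs, hfk⟩ :=
    Literature.Analysis.Fourier.BoasKacNonneg.exists_smooth_autocorr_eq_of_fourier_nonneg hb hk.1 hks
      fun ξ ↦ by
        rw [fourierIntegral_eq_weilMellin_half]
        exact hpos _
  exact ⟨f, ⟨hf, hfc⟩, hfs, hfk⟩

/-- **Weil positivity on `[-b, b]` ⇒ nonnegativity of `W` on the cone of nonnegative transforms of
the window `[-2b, 2b]`**: if `WeilPositivityOn b` (`b > 0`) then `Re W(k) ≥ 0` for every test `k`
supported in `[-2b, 2b]` with `Re k̂(½+it) ≥ 0` for all real `t` (hermitian symmetrisation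
`re_weilFunctional_nonneg_of_factor` + the factorisation above). [cite: Krein1940] -/
theorem re_weilFunctional_nonneg_of_weilPositivityOn (hb : 0 < b) (hpos : WeilPositivityOn b)
    (hk : IsWeilTest k) (hks : tsupport k ⊆ Icc (-(2 * b)) (2 * b))
    (hre : ∀ t : ℝ, 0 ≤ (weilMellin k (1 / 2 + t * I)).re) : 0 ≤ (weilFunctional k).re :=
  re_weilFunctional_nonneg_of_factor (R := 2 * b) hpos
    (fun _ hk hks h ↦ exists_sq_eq_of_weilMellin_nonneg hb hk hks h) hk hks hre

/-! ## Cutoffs -/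

/-- A sequence of continuous compactly supported cutoffs `χ_n : ℝ → [0, 1]` with `χ_n = 1` on
`[-(n+1), n+1]` (smooth bumps of radii `n+1 < n+2`). [folklore] -/
private theorem exists_cutoff_seq :
    ∃ χ : ℕ → ℝ → ℝ, (∀ n t, 0 ≤ χ n t) ∧ (∀ n t, χ n t ≤ 1) ∧
      (∀ (n : ℕ) (t : ℝ), |t| ≤ (n : ℝ) + 1 → χ n t = 1) ∧ (∀ n, Continuous (χ n)) ∧
        ∀ n, HasCompactSupport (χ n) := by
  let B : ℕ → ContDiffBump (0 : ℝ) := fun n ↦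
    ⟨(n : ℝ) + 1, (n : ℝ) + 2, by positivity, by linarith⟩
  refine ⟨fun n ↦ (B n : ℝ → ℝ), fun n t ↦ (B n).nonneg, fun n t ↦ (B n).le_one,
    fun n t ht ↦ ?_, fun n ↦ (B n).continuous, fun n ↦ (B n).hasCompactSupport⟩
  refine (B n).one_of_mem_closedBall ?_
  rw [Metric.mem_closedBall, Real.dist_eq, sub_zero]
  exact ht

/-! ## The representation on squares, for a given Riesz extension -/

/-- **Tightness and the identity `Q(g) = ∫ ‖ĝ(½+it)‖² dμ`.**  Let `Λ` be a positive functional on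
`C_c(ℝ, ℝ)` with `Re W(k) + Λ c ≥ 0` whenever `k` is a test supported in `[-2b, 2b]` and
`Re k̂(½+it) + c(t) ≥ 0` for all `t` (the output of `exists_positive_extension`), and let `μ` be its
Riesz–Markov–Kakutani measure.  Then for every test `g` supported in `[-b, b]` the function
`t ↦ ‖ĝ(½+it)‖²` is `μ`-integrable and `Q(g) = W(g ⋆ g̃) = ∫ ‖ĝ(½+it)‖² dμ(t)` (as a complex number;
`Q(g)` is real).  Sandwich `Q(g) - (n+1)⁻² Re W(g′ ⋆ g̃′) ≤ ∫ χ_n ‖ĝ‖² dμ ≤ Q(g)` from positivity of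
the extension on `(g ⋆ g̃, -χ_n‖ĝ‖²)` and `((n+1)⁻²·g′ ⋆ g̃′ - g ⋆ g̃, χ_n‖ĝ‖²)`, using
`(g′)^(½+it) = -it·ĝ(½+it)`; then Fatou and dominated convergence. [cite: Krein1940] -/
theorem integrable_and_weilQuadratic_eq_integral (Λ : C_c(ℝ, ℝ) →ₚ[ℝ] ℝ)
    (hΛ : ∀ k : ℝ → ℂ, IsWeilTest k → tsupport k ⊆ Icc (-(2 * b)) (2 * b) →
      ∀ c : C_c(ℝ, ℝ), (∀ t : ℝ, 0 ≤ (weilMellin k (1 / 2 + t * I)).re + c t) →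
        0 ≤ (weilFunctional k).re + Λ c)
    (hg : IsWeilTest g) (hgs : tsupport g ⊆ Icc (-b) b) :
    Integrable (fun t : ℝ ↦ ‖weilMellin g (1 / 2 + t * I)‖ ^ 2) (RealRMK.rieszMeasure Λ) ∧
      weilQuadratic g =
        ((∫ t, ‖weilMellin g (1 / 2 + t * I)‖ ^ 2 ∂(RealRMK.rieszMeasure Λ) : ℝ) : ℂ) := by
  set μ := RealRMK.rieszMeasure Λ with hμ
  -- the spectral density `F = ‖ĝ(½+it)‖²`
  set F : ℝ → ℝ := fun t ↦ ‖weilMellin g (1 / 2 + t * I)‖ ^ 2 with hF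
  have hFc : Continuous F := by
    have h1 : Continuous fun t : ℝ ↦ (1 / 2 : ℂ) + t * I := by fun_prop
    exact ((continuous_weilMellin hg.1.continuous hg.2).comp h1).norm.pow 2
  have hF0 : ∀ t, 0 ≤ F t := fun t ↦ by positivity
  -- the square `k = g ⋆ g̃`
  set k := weilConv g (weilReflect g) with hk_def
  have hk : IsWeilTest k := hg.weilConv hg.weilReflect
  have hks : tsupport k ⊆ Icc (-(2 * b)) (2 * b) := tsupport_weilConv_weilReflect_subset hg.2 hgs
  have hkF : ∀ t : ℝ, (weilMellin k (1 / 2 + t * I)).re = F t := fun t ↦ by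
    rw [hk_def, weilMellin_weilConv_weilReflect_half hg, Complex.ofReal_re]
  have hQre : (weilQuadratic g).re = (weilFunctional k).re := rfl
  -- the derivative square `k₊ = g′ ⋆ g̃′`, `Re k̂₊(½+it) = t² F(t)`
  have hg' : IsWeilTest (deriv g) := hg.deriv
  have hg's : tsupport (deriv g) ⊆ Icc (-b) b := tsupport_deriv_subset.trans hgs
  set kp := weilConv (deriv g) (weilReflect (deriv g)) with hkp_def
  have hkp : IsWeilTest kp := hg'.weilConv hg'.weilReflect
  have hkps : tsupport kp ⊆ Icc (-(2 * b)) (2 * b) :=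
    tsupport_weilConv_weilReflect_subset hg'.2 hg's
  have hkpF : ∀ t : ℝ, (weilMellin kp (1 / 2 + t * I)).re = t ^ 2 * F t := fun t ↦ by
    rw [hkp_def, weilMellin_weilConv_weilReflect_half hg', Complex.ofReal_re, weilMellin_deriv hg,
      norm_mul]
    have : ‖-((1 : ℂ) / 2 + t * I - 1 / 2)‖ = |t| := by
      have e : -((1 : ℂ) / 2 + t * I - 1 / 2) = -(t * I) := by ring
      rw [e, norm_neg, norm_mul, Complex.norm_real, Complex.norm_I, mul_one, Real.norm_eq_abs]
    rw [this, mul_pow, sq_abs]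
  -- cutoffs and the compactly supported densities `χ_n F`
  obtain ⟨χ, hχ0, hχ1, hχone, hχc, hχcs⟩ := exists_cutoff_seq
  let c : ℕ → C_c(ℝ, ℝ) := fun n ↦
    ⟨⟨fun t ↦ χ n t * F t, (hχc n).mul hFc⟩, (hχcs n).mul_right⟩
  have hc : ∀ n t, c n t = χ n t * F t := fun n t ↦ rfl
  have hcint : ∀ n, ∫ t, χ n t * F t ∂μ = Λ (c n) := fun n ↦
    RealRMK.integral_rieszMeasure Λ (c n)
  have hcF0 : ∀ n t, 0 ≤ χ n t * F t := fun n t ↦ mul_nonneg (hχ0 n t) (hF0 t)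
  have hcFle : ∀ n t, χ n t * F t ≤ F t := fun n t ↦ mul_le_of_le_one_left (hF0 t) (hχ1 n t)
  -- (1) lower bound `∫ χ_n F dμ ≤ Q(g)`
  have hlow : ∀ n, ∫ t, χ n t * F t ∂μ ≤ (weilQuadratic g).re := fun n ↦ by
    have h := hΛ k hk hks (-(c n)) fun t ↦ by
      rw [hkF, CompactlySupportedContinuousMap.neg_apply, hc]
      linarith [hcFle n t]
    rw [map_neg] at h
    rw [hQre, hcint]
    linarith
  -- (2) upper bound `Q(g) ≤ ∫ χ_n F dμ + (n+1)⁻² Re W(k₊)`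
  set ε : ℕ → ℝ := fun n ↦ (1 / ((n : ℝ) + 1)) ^ 2 with hε
  have hup : ∀ n, (weilQuadratic g).re ≤ ∫ t, χ n t * F t ∂μ + ε n * (weilFunctional kp).re := by
    intro n
    have hkp1 := isWeilTest_smul_real hkp (ε n)
    have hk1 := isWeilTest_smul_real hk (-1)
    have hk' : IsWeilTest (ε n • kp + (-1 : ℝ) • k) := hkp1.add hk1
    have hk's : tsupport (ε n • kp + (-1 : ℝ) • k) ⊆ Icc (-(2 * b)) (2 * b) :=
      (tsupport_add _ _).trans (union_subset ((tsupport_smul_real_subset _ _).trans hkps)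
        ((tsupport_smul_real_subset _ _).trans hks))
    have hk'F : ∀ t : ℝ, (weilMellin (ε n • kp + (-1 : ℝ) • k) (1 / 2 + t * I)).re =
        ε n * (t ^ 2 * F t) - F t := fun t ↦ by
      rw [weilMellin_add hkp1.1.continuous hkp1.2 hk1.1.continuous hk1.2, weilMellin_smul_real,
        weilMellin_smul_real, add_re, re_ofReal_mul, re_ofReal_mul, hkpF, hkF]
      ring
    have hk'W : (weilFunctional (ε n • kp + (-1 : ℝ) • k)).re =
        ε n * (weilFunctional kp).re - (weilFunctional k).re := by
      rw [weilFunctional_add hkp1 hk1, weilFunctional_smul_real, weilFunctional_smul_real, add_re,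
        re_ofReal_mul, re_ofReal_mul]
      ring
    have hn : (0 : ℝ) < (n : ℝ) + 1 := by positivity
    have h := hΛ _ hk' hk's (c n) fun t ↦ by
      rw [hk'F, hc]
      by_cases ht : |t| ≤ n + 1
      · rw [hχone n t ht]
        have : 0 ≤ ε n * (t ^ 2 * F t) := by positivity
        linarith
      · rw [not_le] at ht
        have h1 : 1 ≤ ε n * t ^ 2 := by
          have h2 : 1 ≤ |t| / ((n : ℝ) + 1) := by
            rw [le_div_iff₀ hn]
            linarith
          have h3 : ε n * t ^ 2 = (|t| / ((n : ℝ) + 1)) ^ 2 := by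
            simp only [hε, div_pow, one_pow, sq_abs]
            ring
          rw [h3]
          nlinarith
        have h4 : F t ≤ ε n * (t ^ 2 * F t) := by
          have := mul_le_mul_of_nonneg_right h1 (hF0 t)
          linarith [this]
        linarith [hcF0 n t]
    rw [hk'W] at h
    rw [hQre, hcint]
    linarith
  -- (3) `F ∈ L¹(μ)` by Fatou
  have hcmeas : ∀ n, Measurable fun t ↦ ENNReal.ofReal (χ n t * F t) := fun n ↦
    ((hχc n).mul hFc).measurable.ennreal_ofReal
  have hcn_int : ∀ n, Integrable (fun t ↦ χ n t * F t) μ := fun n ↦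
    (c n).continuous.integrable_of_hasCompactSupport (c n).hasCompactSupport
  have hpt : ∀ t, ∀ᶠ n : ℕ in atTop, χ n t * F t = F t := fun t ↦ by
    refine (eventually_ge_atTop ⌈|t|⌉₊).mono fun n hn ↦ ?_
    rw [hχone n t ?_, one_mul]
    have : (⌈|t|⌉₊ : ℝ) ≤ n := by exact_mod_cast hn
    linarith [Nat.le_ceil |t|]
  have hptT : ∀ t, Tendsto (fun n : ℕ ↦ χ n t * F t) atTop (𝓝 (F t)) := fun t ↦
    tendsto_const_nhds.congr' ((hpt t).mono fun n hn ↦ hn.symm)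
  have hlint : ∫⁻ t, ENNReal.ofReal (F t) ∂μ ≤ ENNReal.ofReal ((weilQuadratic g).re) := by
    calc ∫⁻ t, ENNReal.ofReal (F t) ∂μ
        = ∫⁻ t, liminf (fun n ↦ ENNReal.ofReal (χ n t * F t)) atTop ∂μ := by
          refine lintegral_congr fun t ↦ ?_
          exact ((ENNReal.tendsto_ofReal (hptT t)).liminf_eq).symm
      _ ≤ liminf (fun n ↦ ∫⁻ t, ENNReal.ofReal (χ n t * F t) ∂μ) atTop :=
          lintegral_liminf_le hcmeas
      _ ≤ ENNReal.ofReal ((weilQuadratic g).re) := by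
          refine liminf_le_of_frequently_le' (Frequently.of_forall fun n ↦ ?_)
          rw [← ofReal_integral_eq_lintegral_ofReal (hcn_int n) (ae_of_all _ (hcF0 n))]
          exact ENNReal.ofReal_le_ofReal (hlow n)
  have hFint : Integrable F μ := by
    refine ⟨hFc.aestronglyMeasurable, ?_⟩
    rw [hasFiniteIntegral_iff_ofReal (ae_of_all _ hF0)]
    exact hlint.trans_lt ENNReal.ofReal_lt_top
  -- (4) `∫ χ_n F dμ → ∫ F dμ` by dominated convergence, and the sandwich
  have hlim : Tendsto (fun n ↦ ∫ t, χ n t * F t ∂μ) atTop (𝓝 (∫ t, F t ∂μ)) :=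
    tendsto_integral_of_dominated_convergence F
      (fun n ↦ ((hχc n).mul hFc).aestronglyMeasurable) hFint
      (fun n ↦ ae_of_all _ fun t ↦ by
        rw [Real.norm_eq_abs, abs_of_nonneg (hcF0 n t)]
        exact hcFle n t)
      (ae_of_all _ hptT)
  have hεlim : Tendsto (fun n ↦ ε n * (weilFunctional kp).re) atTop (𝓝 0) := by
    have h1 : Tendsto ε atTop (𝓝 0) := by
      have h0 := (tendsto_one_div_add_atTop_nhds_zero_nat (𝕜 := ℝ)).pow 2
      simp only [hε]
      simpa using h0
    simpa using h1.mul_const (weilFunctional kp).re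
  have hre : (weilQuadratic g).re = ∫ t, F t ∂μ := by
    refine le_antisymm ?_ (le_of_tendsto' hlim hlow)
    have h2 := hlim.add hεlim
    rw [add_zero] at h2
    exact ge_of_tendsto' h2 hup
  refine ⟨hFint, Complex.ext ?_ ?_⟩
  · rw [hre, Complex.ofReal_re]
  · rw [weilQuadratic_im_holds hg, Complex.ofReal_im]

/-! ## The theorems -/

/-- **Bochner–Kreĭn representation of the Weil functional on a window.**  If `WeilPositivityOn b`
(`b > 0`: `Re W(g ⋆ g̃) ≥ 0` for every smooth `g` supported in `[-b, b]`), then there is a positive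
regular Borel measure `μ` on `ℝ` such that for EVERY smooth `g` supported in `[-b, b]` the spectral
density `t ↦ ‖ĝ(½+it)‖²` is `μ`-integrable and

  `W(g ⋆ g̃) = ∫ ‖ĝ(½ + it)‖² dμ(t)`.

So a proved window `b` says: to all observables with prime-side support in `[-2b, 2b]` the zeros of
`ζ` are a positive measure on the critical line (under RH, `μ = Σ_γ m_γ δ_γ` for every `b`).  The
measure is not unique.  Kreĭn's extension theorem (1940) in M. Riesz's form
(`exists_positive_extension`) + Riesz–Markov–Kakutani + the tightness argument of
`integrable_and_weilQuadratic_eq_integral`. [cite: Krein1940] -/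
theorem exists_measure_of_weilPositivityOn (hb : 0 < b) (hpos : WeilPositivityOn b) :
    ∃ μ : Measure ℝ, μ.Regular ∧ ∀ g : ℝ → ℂ, IsWeilTest g → tsupport g ⊆ Icc (-b) b →
      Integrable (fun t : ℝ ↦ ‖weilMellin g (1 / 2 + t * I)‖ ^ 2) μ ∧
        weilQuadratic g = ((∫ t, ‖weilMellin g (1 / 2 + t * I)‖ ^ 2 ∂μ : ℝ) : ℂ) := by
  obtain ⟨Λ, hΛ⟩ := exists_positive_extension (R := 2 * b) (by positivity)
    fun k hk hks hre ↦ re_weilFunctional_nonneg_of_weilPositivityOn hb hpos hk hks hre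
  exact ⟨RealRMK.rieszMeasure Λ, inferInstance, fun g hg hgs ↦
    integrable_and_weilQuadratic_eq_integral Λ hΛ hg hgs⟩

/-- **Weil positivity on a window ⟺ representability by a positive measure on the critical line.**
For `b > 0`: `WeilPositivityOn b ↔ ∃ μ (measure on ℝ), ∀ g smooth with supp g ⊆ [-b, b],
Re W(g ⋆ g̃) = ∫ ‖ĝ(½+it)‖² dμ(t)`.  (`→` is `exists_measure_of_weilPositivityOn`; `←` is
`∫ ‖ĝ‖² dμ ≥ 0`.)  With `riemannHypothesis_iff_forall_weilPositivityOn` this reads: RH holds iff for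
every bandwidth there is a positive measure on the line reproducing the explicit formula on all test
autocorrelations of that bandwidth. [cite: Krein1940] -/
theorem weilPositivityOn_iff_exists_measure (hb : 0 < b) :
    WeilPositivityOn b ↔ ∃ μ : Measure ℝ, ∀ g : ℝ → ℂ, IsWeilTest g → tsupport g ⊆ Icc (-b) b →
      (weilQuadratic g).re = ∫ t, ‖weilMellin g (1 / 2 + t * I)‖ ^ 2 ∂μ := by
  constructor
  · intro hpos
    obtain ⟨μ, -, hμ⟩ := exists_measure_of_weilPositivityOn hb hpos
    refine ⟨μ, fun g hg hgs ↦ ?_⟩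
    rw [(hμ g hg hgs).2, Complex.ofReal_re]
  · rintro ⟨μ, hμ⟩ g hg hgs
    rw [hμ g hg hgs]
    exact integral_nonneg fun t ↦ by positivity

end WeilBochner

end Literature.NumberTheory.LFunctions

end
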